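import Summits.QuantumFields.YangMills.Theorems.FluctuationComparisonRegPrIntLS2BetaChartReadIterFromSup
import HarnessLib

/-!
# S2β · (REG-UP)′ bridge (O2-b3-β3c, part 1) — «THE SEGMENT CHAIN RULE»: the derivative of the `(n+1)`-step chart-read from level `k₀` is the one-step derivative at level `k₀ + n`
# (about `Ū_{k₀}^{n} W`) composed with the `n`-step one — `D Ψ^{W}_{k₀,n+1}(0) = Dψ_{Ū_{k₀}^{n}W}(0) ∘L D Ψ^{W}_{k₀,n}(0)` — and `D Ψ^{W}_{k₀,0}(0) = id`; by transport to the shorter tower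
# (✓p840392 §3) + the level-`0` chain rule there (✓`fderiv_chartRead_iter_succ`) + the NATURALITY of the one-step chart-read under the tower identifications (lit ✓`avgFun_fieldShift`)

Cell `ym3-torus` (YM ladder rung R3 = continuum `SU(2)` Yang–Mills on the three-torus at fixed lattice data — a RUNG: NOT d = 4, NOT infinite volume, NOT a mass gap,
NOT Clay).  Width seat «width 12» `ym3-torus-px12` (gen 27); crux `stmt-QuantumFields-20520`, LINE g18-1 S2β, node (REG-UP)′ (hDcov assembly — the `hLip` telescope's segment recursion).
`--kind proof --supports stmt-QuantumFields-20520 --as helper`, count-neutral, DEFINITION-FREE (0 `def`, 0 `instance`, 0 `notation`, 0 `sorry`, default heartbeats).  `SU(N)`, `T3Family` towers.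

WHAT IS PROVED (sorry-free).
§1 (any two towers `F.PP m K`, `F.PP m′ K′` with matched level pairs `h₀ : sPD j = sPD′ j′`, `h₁ : sPD (j+1) = sPD′ (j′+1)`) ★`chartRead_avgFun_fieldShift` — the one-step chart-read is NATURAL:
   `ψ_{fieldShift h₀ V}(B ∘ bondShift h₀)(c̃) = ψ_{V}(B)(bondShift h₁ c̃)`; ★`chartRead_avgFun_fieldShift_symm` (the `T_out` form); ★★`fderiv_chartRead_avgFun_fieldShift` — on the (0.4) guard of `V`:
   `T_out¹ ∘L Dψ_{fieldShift h₀ V}(0) = Dψ_{V}(0) ∘L T_out⁰` (`T_outʲ Ỹ := Ỹ ∘ (bondShift hⱼ)⁻¹`).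
§2 (`F.P K`, base level `k₀`, loop guards `α_i < δ_N` of `Ū_{k₀}^{i} W`) ★★★**`fderiv_chartReadFrom_succ (hk : k₀ + n + 1 ≤ m + K) : fderiv ℝ Ψ^{W}_{k₀,n+1} 0 = (fderiv ℝ ψ_{Ū_{k₀}^{n}W} 0).comp (fderiv ℝ Ψ^{W}_{k₀,n} 0)`**;
   ★★`fderiv_chartReadFrom_zero : fderiv ℝ Ψ^{W}_{k₀,0} 0 = ContinuousLinearMap.id`.

HONEST SCOPE.  Chain-rule plumbing across the tower identifications; nothing of Bałaban's renormalisation-group analysis proved ([Balaban1987RG1] (0.11) p.253, [Balaban1985Averaging] Prop. 4 (127) p.37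
are the printed loci); the `hLip` sum identity∕bound (part 2), (hNL)∕(REG-UP)′∕GAP♯∘ (`stub_uniformFibreGapOrbit`, registry 3732b7df UNTOUCHED, 0∕5), the five registered stubs, S2β, crux 20520,
19936, 19200, `YM3TorusSU2` — NOT proved; rung R3 — NOT d = 4, NOT infinite volume, NOT a mass gap, NOT Clay; the Yang–Mills mass gap is NOT proved.
-/

set_option autoImplicit false

noncomputable section

open scoped Matrix.Norms.L2Operator Topology
open Filter Set Function

namespace Summit.QuantumFields.YangMills.Theorems.FluctuationComparisonRegPrIntLS2BetaChartReadIterFromChainRule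

open Literature.MathematicalPhysics.QuantumFieldTheory.Balaban1983to89
open Literature.MathematicalPhysics.QuantumFieldTheory.Balaban1983to89.HaarExponentialChart
open Literature.MathematicalPhysics.QuantumFieldTheory.Balaban1983to89.HaarExponentialChart.IsChartRep
open Literature.MathematicalPhysics.QuantumFieldTheory.Balaban1983to89.BlockAveraging (Small Idx avgFun loopHol blockAvg blockAvg_avg)
open Literature.MathematicalPhysics.QuantumFieldTheory.Balaban1983to89.ExpMeanLog (expMeanLogSU deltaSU)
open Literature.MathematicalPhysics.QuantumFieldTheory.Balaban1983to89.Node00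
open Literature.MathematicalPhysics.QuantumFieldTheory.Balaban1983to89.T3ContinuumYM3Torus
open Literature.MathematicalPhysics.QuantumFieldTheory.Balaban1983to89.T3LevelShift
open Literature.MathematicalPhysics.QuantumFieldTheory.Balaban1983to89.T4AvgSensitivity (iterFrom)
open Summit.QuantumFields.YangMills.BalabanUVNodes.N09ChartReadAveragingSmooth
open Summit.QuantumFields.YangMills.Theorems.FluctuationComparisonRegPrIntLS2BetaChartReadDescentOnto (contDiffAt_chartRead_iter)
open Summit.QuantumFields.YangMills.Theorems.FluctuationComparisonRegPrIntLS2BetaChartReadDescentChainRule (fderiv_chartRead_iter_succ fderiv_chartRead_iter_zero)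
open Summit.QuantumFields.YangMills.Theorems.FluctuationComparisonRegPrIntLS2BetaChartReadIterFromSup (smallBelow_shift_of_loopGuard fderiv_chartReadFrom_eq)

variable {N : ℕ} [NeZero N] {F : T3Family}

/-! ## §1 The one-step chart-read is natural under the tower identifications -/

section Naturality

variable {m K j m' K' j' : ℕ}

/-- ★ **NATURALITY OF THE ONE-STEP CHART-READ**: `ψ_{fieldShift h₀ V}(B ∘ bondShift h₀)(c̃) = ψ_{V}(B)(bondShift h₁ c̃)` (lit ✓`avgFun_fieldShift` on both factors). [cite: Balaban1987RG1, (0.2), (0.4) pp.252-253] -/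
theorem chartRead_avgFun_fieldShift (h₀ : (F.PP m K).sitesPerDir j = (F.PP m' K').sitesPerDir j') (h₁ : (F.PP m K).sitesPerDir (j + 1) = (F.PP m' K').sitesPerDir (j' + 1))
    (V : GaugeField (F.PP m' K') j' (SU N)) (B : PBond (F.PP m' K') j' → (specialUnitaryLogChart (Fin N)).lie) (c : PBond (F.PP m K) (j + 1)) :
    (isChartRep_specialUnitaryGroup (n := Fin N)).logChart
        (avgFun (expMeanLogSU (n := Fin N)) (fun b => (isChartRep_specialUnitaryGroup (n := Fin N)).expChart ((fun ℓ => B (bondShift h₀ ℓ)) b) * fieldShift h₀ V b) c *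
          (avgFun (expMeanLogSU (n := Fin N)) (fieldShift h₀ V) c)⁻¹) =
      (isChartRep_specialUnitaryGroup (n := Fin N)).logChart
        (avgFun (expMeanLogSU (n := Fin N)) (fun b => (isChartRep_specialUnitaryGroup (n := Fin N)).expChart (B b) * V b) (bondShift h₁ c) *
          (avgFun (expMeanLogSU (n := Fin N)) V (bondShift h₁ c))⁻¹) := by
  have hΘ : (fun b : PBond (F.PP m K) j => (isChartRep_specialUnitaryGroup (n := Fin N)).expChart ((fun ℓ => B (bondShift h₀ ℓ)) b) * fieldShift h₀ V b) =
      fieldShift h₀ (fun b => (isChartRep_specialUnitaryGroup (n := Fin N)).expChart (B b) * V b) := by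
    funext b
    simp only [fieldShift_apply]
  rw [hΘ, avgFun_fieldShift (expMeanLogSU (n := Fin N)) h₀ h₁, avgFun_fieldShift (expMeanLogSU (n := Fin N)) h₀ h₁, fieldShift_apply, fieldShift_apply]

/-- ★ **THE `T_out` FORM**: `ψ_{fieldShift h₀ V}(Ỹ)((bondShift h₁)⁻¹ c) = ψ_{V}(Ỹ ∘ (bondShift h₀)⁻¹)(c)`. [cite: Balaban1987RG1, (0.2), (0.4) pp.252-253] -/
theorem chartRead_avgFun_fieldShift_symm (h₀ : (F.PP m K).sitesPerDir j = (F.PP m' K').sitesPerDir j') (h₁ : (F.PP m K).sitesPerDir (j + 1) = (F.PP m' K').sitesPerDir (j' + 1))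
    (V : GaugeField (F.PP m' K') j' (SU N)) (Y : PBond (F.PP m K) j → (specialUnitaryLogChart (Fin N)).lie) (c : PBond (F.PP m' K') (j' + 1)) :
    (isChartRep_specialUnitaryGroup (n := Fin N)).logChart
        (avgFun (expMeanLogSU (n := Fin N)) (fun b => (isChartRep_specialUnitaryGroup (n := Fin N)).expChart (Y b) * fieldShift h₀ V b) ((bondShift h₁).symm c) *
          (avgFun (expMeanLogSU (n := Fin N)) (fieldShift h₀ V) ((bondShift h₁).symm c))⁻¹) =
      (isChartRep_specialUnitaryGroup (n := Fin N)).logChart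
        (avgFun (expMeanLogSU (n := Fin N)) (fun b => (isChartRep_specialUnitaryGroup (n := Fin N)).expChart ((fun b' => Y ((bondShift h₀).symm b')) b) * V b) c *
          (avgFun (expMeanLogSU (n := Fin N)) V c)⁻¹) := by
  have hY : Y = fun ℓ => (fun b' => Y ((bondShift h₀).symm b')) (bondShift h₀ ℓ) := by
    funext ℓ; simp only [Equiv.symm_apply_apply]
  have h := chartRead_avgFun_fieldShift (N := N) h₀ h₁ V (fun b' => Y ((bondShift h₀).symm b')) ((bondShift h₁).symm c)
  rw [Equiv.apply_symm_apply] at h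
  rw [← h]
  simp only [Equiv.symm_apply_apply]

/-- ★★ **NATURALITY OF THE ONE-STEP DERIVATIVE** (operator form, on the (0.4) guard of `V`): `T_out¹ ∘L Dψ_{fieldShift h₀ V}(0) = Dψ_{V}(0) ∘L T_out⁰`
with `T_outʲ Ỹ := Ỹ ∘ (bondShift hⱼ)⁻¹`. [cite: Balaban1987RG1, (0.2), (0.4), (0.11) pp.252-253; Balaban1985Averaging, Prop. 4 (127) p.37] -/
theorem fderiv_chartRead_avgFun_fieldShift (h₀ : (F.PP m K).sitesPerDir j = (F.PP m' K').sitesPerDir j') (h₁ : (F.PP m K).sitesPerDir (j + 1) = (F.PP m' K').sitesPerDir (j' + 1))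
    (V : GaugeField (F.PP m' K') j' (SU N)) (hsmall : ∀ c, Small (expMeanLogSU (n := Fin N)) V c) :
    (ContinuousLinearMap.pi fun (c : PBond (F.PP m' K') (j' + 1)) =>
        ContinuousLinearMap.proj (R := ℝ) (φ := fun _ : PBond (F.PP m K) (j + 1) => (specialUnitaryLogChart (Fin N)).lie) ((bondShift h₁).symm c)).comp
      (fderiv ℝ (fun (Y : PBond (F.PP m K) j → (specialUnitaryLogChart (Fin N)).lie) (c : PBond (F.PP m K) (j + 1)) =>
        (isChartRep_specialUnitaryGroup (n := Fin N)).logChart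
          (avgFun (expMeanLogSU (n := Fin N)) (fun b => (isChartRep_specialUnitaryGroup (n := Fin N)).expChart (Y b) * fieldShift h₀ V b) c *
            (avgFun (expMeanLogSU (n := Fin N)) (fieldShift h₀ V) c)⁻¹)) 0) =
    (fderiv ℝ (fun (B : PBond (F.PP m' K') j' → (specialUnitaryLogChart (Fin N)).lie) (c : PBond (F.PP m' K') (j' + 1)) =>
        (isChartRep_specialUnitaryGroup (n := Fin N)).logChart
          (avgFun (expMeanLogSU (n := Fin N)) (fun b => (isChartRep_specialUnitaryGroup (n := Fin N)).expChart (B b) * V b) c *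
            (avgFun (expMeanLogSU (n := Fin N)) V c)⁻¹)) 0).comp
      (ContinuousLinearMap.pi fun (b : PBond (F.PP m' K') j') =>
        ContinuousLinearMap.proj (R := ℝ) (φ := fun _ : PBond (F.PP m K) j => (specialUnitaryLogChart (Fin N)).lie) ((bondShift h₀).symm b)) := by
  set ψt := fun (Y : PBond (F.PP m K) j → (specialUnitaryLogChart (Fin N)).lie) (c : PBond (F.PP m K) (j + 1)) =>
      (isChartRep_specialUnitaryGroup (n := Fin N)).logChart
        (avgFun (expMeanLogSU (n := Fin N)) (fun b => (isChartRep_specialUnitaryGroup (n := Fin N)).expChart (Y b) * fieldShift h₀ V b) c *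
          (avgFun (expMeanLogSU (n := Fin N)) (fieldShift h₀ V) c)⁻¹) with hψt
  set ψ := fun (B : PBond (F.PP m' K') j' → (specialUnitaryLogChart (Fin N)).lie) (c : PBond (F.PP m' K') (j' + 1)) =>
      (isChartRep_specialUnitaryGroup (n := Fin N)).logChart
        (avgFun (expMeanLogSU (n := Fin N)) (fun b => (isChartRep_specialUnitaryGroup (n := Fin N)).expChart (B b) * V b) c *
          (avgFun (expMeanLogSU (n := Fin N)) V c)⁻¹) with hψ
  set T1 : (PBond (F.PP m K) (j + 1) → (specialUnitaryLogChart (Fin N)).lie) →L[ℝ] (PBond (F.PP m' K') (j' + 1) → (specialUnitaryLogChart (Fin N)).lie) :=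
    ContinuousLinearMap.pi fun (c : PBond (F.PP m' K') (j' + 1)) =>
      ContinuousLinearMap.proj (R := ℝ) (φ := fun _ : PBond (F.PP m K) (j + 1) => (specialUnitaryLogChart (Fin N)).lie) ((bondShift h₁).symm c) with hT1
  set T0 : (PBond (F.PP m K) j → (specialUnitaryLogChart (Fin N)).lie) →L[ℝ] (PBond (F.PP m' K') j' → (specialUnitaryLogChart (Fin N)).lie) :=
    ContinuousLinearMap.pi fun (b : PBond (F.PP m' K') j') =>
      ContinuousLinearMap.proj (R := ℝ) (φ := fun _ : PBond (F.PP m K) j => (specialUnitaryLogChart (Fin N)).lie) ((bondShift h₀).symm b) with hT0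
  -- the function identity `T1 ∘ ψ̃ = ψ ∘ T0`
  have hfun : (⇑T1 ∘ ψt) = (ψ ∘ ⇑T0) := by
    funext Y
    funext c
    simp only [Function.comp_apply, hT1, hT0, hψt, hψ, ContinuousLinearMap.pi_apply, ContinuousLinearMap.proj_apply]
    exact chartRead_avgFun_fieldShift_symm (N := N) h₀ h₁ V Y c
  -- differentiability of both one-step maps at `0`
  have hsmallt : ∀ c, Small (expMeanLogSU (n := Fin N)) (fieldShift h₀ V) c := fun c =>
    (small_fieldShift_iff (expMeanLogSU (n := Fin N)) h₀ h₁ V c).2 (hsmall _)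
  have hψtD : DifferentiableAt ℝ ψt 0 := (contDiffAt_chartRead_avgFun (fieldShift h₀ V) hsmallt).differentiableAt (by simp)
  have hψD : DifferentiableAt ℝ ψ (T0 0) := by
    rw [map_zero]; exact (contDiffAt_chartRead_avgFun V hsmall).differentiableAt (by simp)
  have hL : HasFDerivAt (⇑T1 ∘ ψt) (T1.comp (fderiv ℝ ψt 0)) 0 :=
    HasFDerivAt.comp (𝕜 := ℝ) (f := ψt) (f' := fderiv ℝ ψt 0) (g := ⇑T1) (g' := T1)
      (0 : PBond (F.PP m K) j → (specialUnitaryLogChart (Fin N)).lie) T1.hasFDerivAt hψtD.hasFDerivAt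
  have hR : HasFDerivAt (ψ ∘ ⇑T0) ((fderiv ℝ ψ (T0 0)).comp T0) 0 :=
    HasFDerivAt.comp (𝕜 := ℝ) (f := ⇑T0) (f' := T0) (g := ψ) (g' := fderiv ℝ ψ (T0 0))
      (0 : PBond (F.PP m K) j → (specialUnitaryLogChart (Fin N)).lie) hψD.hasFDerivAt T0.hasFDerivAt
  rw [hfun] at hL
  have h := hL.unique hR
  rw [map_zero] at h
  exact h

end Naturality

/-! ## §2 The segment chain rule on `F.P K` from level `k₀` -/

section Segment

variable (F)

/-- ★★★ **THE SEGMENT CHAIN RULE**: under the loop `α`-guards of `Ū_{k₀}^{i} W` (`i < n + 1`, `α_i < δ_N`) and `k₀ + n + 1 ≤ m + K`,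
`fderiv ℝ Ψ^{W}_{k₀,n+1} 0 = (fderiv ℝ ψ_{Ū_{k₀}^{n} W} 0) ∘L (fderiv ℝ Ψ^{W}_{k₀,n} 0)` — transport to the shorter tower (✓p840392 §3), the level-`0` chain rule there
(✓`fderiv_chartRead_iter_succ`), and §1 for the top factor (lit ✓`iterFrom_fieldShift` identifies the backgrounds). [cite: Balaban1987RG1, (0.11) p.253; Balaban1985Averaging, Prop. 4 (127) p.37] -/
theorem fderiv_chartReadFrom_succ {K k₀ n : ℕ} (hk : k₀ + n + 1 ≤ F.m + K) (W : GaugeField (F.P K) k₀ (SU N)) {α : ℕ → ℝ}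
    (hαδ : ∀ i, α i < deltaSU (Fin N))
    (hα : ∀ i, i < n + 1 → ∀ (c : PBond (F.P K) (k₀ + i + 1)) (idx : Idx (F.P K)),
      dist1 (loopHol (iterFrom (fun i => blockAvg (P := F.P K) (j := i) (expMeanLogSU (n := Fin N))) k₀ i W) c idx) ≤ α i) :
    fderiv ℝ (fun (A : PBond (F.P K) k₀ → (specialUnitaryLogChart (Fin N)).lie) (c : PBond (F.P K) (k₀ + (n + 1))) =>
        (isChartRep_specialUnitaryGroup (n := Fin N)).logChart
          (iterFrom (fun i => blockAvg (P := F.P K) (j := i) (expMeanLogSU (n := Fin N))) k₀ (n + 1)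
              (fun b : PBond (F.P K) k₀ => (isChartRep_specialUnitaryGroup (n := Fin N)).expChart (A b) * W b) c *
            (iterFrom (fun i => blockAvg (P := F.P K) (j := i) (expMeanLogSU (n := Fin N))) k₀ (n + 1) W c)⁻¹)) 0 =
      (fderiv ℝ (fun (B : PBond (F.P K) (k₀ + n) → (specialUnitaryLogChart (Fin N)).lie) (c' : PBond (F.P K) (k₀ + n + 1)) =>
          (isChartRep_specialUnitaryGroup (n := Fin N)).logChart
            (avgFun (expMeanLogSU (n := Fin N))
                (fun c => (isChartRep_specialUnitaryGroup (n := Fin N)).expChart (B c) *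
                  iterFrom (fun i => blockAvg (P := F.P K) (j := i) (expMeanLogSU (n := Fin N))) k₀ n W c) c' *
              (avgFun (expMeanLogSU (n := Fin N)) (iterFrom (fun i => blockAvg (P := F.P K) (j := i) (expMeanLogSU (n := Fin N))) k₀ n W) c')⁻¹)) 0).comp
        (fderiv ℝ (fun (A : PBond (F.P K) k₀ → (specialUnitaryLogChart (Fin N)).lie) (c : PBond (F.P K) (k₀ + n)) =>
          (isChartRep_specialUnitaryGroup (n := Fin N)).logChart
            (iterFrom (fun i => blockAvg (P := F.P K) (j := i) (expMeanLogSU (n := Fin N))) k₀ n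
                (fun b : PBond (F.P K) k₀ => (isChartRep_specialUnitaryGroup (n := Fin N)).expChart (A b) * W b) c *
              (iterFrom (fun i => blockAvg (P := F.P K) (j := i) (expMeanLogSU (n := Fin N))) k₀ n W c)⁻¹)) 0) := by
  -- transport both segment derivatives to the shorter tower
  rw [fderiv_chartReadFrom_eq (N := N) F (K := K) (k₀ := k₀) (n := n + 1) hk W hαδ hα,
    fderiv_chartReadFrom_eq (N := N) F (K := K) (k₀ := k₀) (n := n) (by omega) W hαδ (fun i hi => hα i (by omega))]
  -- the level-`0` chain rule on the shorter tower
  have hsb := smallBelow_shift_of_loopGuard (N := N) F (K := K) (k₀ := k₀) (n := n + 1) hk W hαδ hα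
  rw [fderiv_chartRead_iter_succ (P := F.PP (F.m + K - k₀) 0) (N := N) _ n hsb]
  -- identify the top background of the shorter tower with the transported `Ū_{k₀}^{n} W`
  have hW : Averaging.iter (fun i => blockAvg (P := F.PP (F.m + K - k₀) 0) (j := i) (expMeanLogSU (n := Fin N))) n
        (fieldShift (F.sitesPerDir_eq (m := F.m + K - k₀) (K := 0) (j := 0) (m' := F.m) (K' := K) (j' := k₀) (by omega)) W) =
      fieldShift (F.sitesPerDir_eq (m := F.m + K - k₀) (K := 0) (j := n) (m' := F.m) (K' := K) (j' := k₀ + n) (by omega))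
        (iterFrom (fun i => blockAvg (P := F.P K) (j := i) (expMeanLogSU (n := Fin N))) k₀ n W) :=
    (iterFrom_fieldShift (F := F) (expMeanLogSU (n := Fin N)) (m := F.m) (K := K) (m₂ := F.m + K - k₀) (K₂ := 0) (k₀ := k₀) (by omega) n W).symm
  rw [hW]
  -- the (0.4) guard of `Ū_{k₀}^{n} W` at every coarse bond
  have hsmall : ∀ c, Small (expMeanLogSU (n := Fin N)) (iterFrom (fun i => blockAvg (P := F.P K) (j := i) (expMeanLogSU (n := Fin N))) k₀ n W) c :=
    fun c idx => lt_of_le_of_lt (hα n (Nat.lt_succ_self n) c idx) (hαδ n)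
  have hnat := fderiv_chartRead_avgFun_fieldShift (N := N)
    (F.sitesPerDir_eq (m := F.m + K - k₀) (K := 0) (j := n) (m' := F.m) (K' := K) (j' := k₀ + n) (by omega))
    (F.sitesPerDir_eq (m := F.m + K - k₀) (K := 0) (j := n + 1) (m' := F.m) (K' := K) (j' := k₀ + n + 1) (by omega))
    (iterFrom (fun i => blockAvg (P := F.P K) (j := i) (expMeanLogSU (n := Fin N))) k₀ n W) hsmall
  simp only [← ContinuousLinearMap.comp_assoc]
  congr 2

/-- ★★ **THE EMPTY SEGMENT**: `fderiv ℝ Ψ^{W}_{k₀,0} 0 = id` (`k₀ ≤ m + K`; ✓`fderiv_chartRead_iter_zero` on the shorter tower, `T_out⁰ ∘ T_in = id`). [cite: Balaban1987RG1, (0.11) p.253] -/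
theorem fderiv_chartReadFrom_zero {K k₀ : ℕ} (hk : k₀ ≤ F.m + K) (W : GaugeField (F.P K) k₀ (SU N)) :
    fderiv ℝ (fun (A : PBond (F.P K) k₀ → (specialUnitaryLogChart (Fin N)).lie) (c : PBond (F.P K) (k₀ + 0)) =>
        (isChartRep_specialUnitaryGroup (n := Fin N)).logChart
          (iterFrom (fun i => blockAvg (P := F.P K) (j := i) (expMeanLogSU (n := Fin N))) k₀ 0
              (fun b : PBond (F.P K) k₀ => (isChartRep_specialUnitaryGroup (n := Fin N)).expChart (A b) * W b) c *
            (iterFrom (fun i => blockAvg (P := F.P K) (j := i) (expMeanLogSU (n := Fin N))) k₀ 0 W c)⁻¹)) 0 =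
      ContinuousLinearMap.id ℝ (PBond (F.P K) k₀ → (specialUnitaryLogChart (Fin N)).lie) := by
  have h := fderiv_chartReadFrom_eq (N := N) F (K := K) (k₀ := k₀) (n := 0) (by omega) W (α := fun _ => 0)
    (fun _ => ExpMeanLog.deltaSU_pos (n := Fin N)) (fun i hi => absurd hi (Nat.not_lt_zero i))
  rw [h, fderiv_chartRead_iter_zero]
  refine ContinuousLinearMap.ext fun A => funext fun b => ?_
  simp only [ContinuousLinearMap.comp_apply, ContinuousLinearMap.pi_apply, ContinuousLinearMap.proj_apply, ContinuousLinearMap.id_apply]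
  -- `T_out⁰ (T_in A) b = A (bondShift h₀ ((bondShift h₀′)⁻¹ b))` with `h₀, h₀′` two proofs of the same modulus equality
  exact congrArg A (Equiv.apply_symm_apply _ _)

end Segment

end Summit.QuantumFields.YangMills.Theorems.FluctuationComparisonRegPrIntLS2BetaChartReadIterFromChainRule

end
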